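import Literature.MathematicalPhysics.KineticTheory.StochasticCollisionHardSphereProcess
import HarnessLib

/-!
# Splitting off the first die: `μ^{⊗ℕ} ≅ μ ⊗ μ^{⊗ℕ}`

Topic `Literature/MathematicalPhysics/KineticTheory`. The i.i.d. dice law `KernelGas.dice μ = μ^{⊗ℕ}`
(`Measure.infinitePi`) of the noise-driven hard-sphere gases splits under `u ↦ (u 0, u ∘ succ)` into the law of the
first die times an independent copy of itself: `(dice μ).map (u ↦ (u 0, (u (n+1))ₙ)) = μ ⊗ dice μ`
(`map_uncons_dice`), equivalently `(μ ⊗ dice μ).map cons = dice μ` (`map_cons_prod_dice`), with the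
`MeasurePreserving` forms and the change of variables `∫ F d(dice μ) = ∫ F (cons a v) d(μ ⊗ dice μ)(a, v)`
(`integral_dice_eq_integral_prod`). This is the measure-theoretic half of the strong-Markov / restart step of the
chronological one-kick swap for the kick-matched gas `Z*` (crux line `stein-lindeberg-kick-swap` of
`InformationPercolationEngine.PercolationClosesChaos`, stmt-AtomisticToContinuum-13914, stub S3a, node B3): the first
collision consumes the die `u 0`, the restarted gas is driven by `u ∘ succ`. Proof: Mathlib's uniqueness of the
infinite product on boxes (`Measure.eq_infinitePi`, `Measure.infinitePi_pi`).

References: O. Kallenberg, *Foundations of Modern Probability* (2nd ed. 2002), Lemma 3.10 / Cor. 6.6 (existence and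
uniqueness of infinite product measures; i.i.d. sequences are shift-invariant with independent head) [Kallenberg2002].
-/

noncomputable section

open scoped BigOperators ENNReal
open MeasureTheory Set

namespace Literature.MathematicalPhysics.KineticTheory.KernelGas

variable {U : Type*} [MeasurableSpace U] (μ : Measure U) [IsProbabilityMeasure μ]

/-- `u ↦ (u 0, u ∘ succ)` is measurable. [folklore] -/
theorem measurable_uncons : Measurable fun u : ℕ → U => (u 0, fun n => u (n + 1)) :=
  (measurable_pi_apply 0).prodMk (measurable_pi_lambda _ fun n => measurable_pi_apply (n + 1))

/-- `(a, v) ↦ cons a v = (a, v 0, v 1, …)` is measurable. [folklore] -/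
theorem measurable_cons : Measurable fun q : U × (ℕ → U) => fun n => (Nat.casesOn n q.1 q.2 : U) := by
  refine measurable_pi_lambda _ fun n => ?_
  cases n with
  | zero => exact measurable_fst
  | succ m => exact (measurable_pi_apply m).comp measurable_snd

omit [MeasurableSpace U] in
/-- The preimage of a finite-dimensional box under `cons`: a product of a constraint on the head and a box on the
tail. [folklore] -/
theorem cons_preimage_pi (s : Finset ℕ) (t : ℕ → Set U) :
    (fun q : U × (ℕ → U) => fun n => (Nat.casesOn n q.1 q.2 : U)) ⁻¹' Set.pi (↑s) t =
      (if 0 ∈ s then t 0 else univ) ×ˢ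
        Set.pi (↑(s.preimage Nat.succ Nat.succ_injective.injOn)) (fun m => t (m + 1)) := by
  ext q
  simp only [mem_preimage, mem_pi, Finset.mem_coe, mem_prod, Finset.mem_preimage]
  constructor
  · intro h
    refine ⟨?_, fun m hm => h (m + 1) hm⟩
    split_ifs with h0
    · exact h 0 h0
    · exact mem_univ _
  · rintro ⟨h0, h⟩ n hn
    cases n with
    | zero => rw [if_pos hn] at h0; exact h0
    | succ m => exact h m hn

omit [MeasurableSpace U] in
/-- Splitting a finite product over naturals into the factor at `0` and the factors at nonzero indices. [folklore] -/
theorem prod_eq_ite_mul_prod_filter_ne_zero (s : Finset ℕ) (f : ℕ → ℝ≥0∞) :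
    ∏ n ∈ s, f n = (if 0 ∈ s then f 0 else 1) * ∏ n ∈ s.filter (· ≠ 0), f n := by
  rw [← Finset.prod_filter_mul_prod_filter_not s (fun n => n = 0)]
  congr 1
  rw [Finset.filter_eq' s 0]
  split_ifs <;> simp

/-- **`cons` pushes `μ ⊗ μ^{⊗ℕ}` to `μ^{⊗ℕ}`**: prepending an independent `μ`-distributed head to an i.i.d. `μ`
sequence gives an i.i.d. `μ` sequence (checked on boxes, `Measure.eq_infinitePi`). [folklore] -/
theorem map_cons_prod_dice :
    (μ.prod (dice μ)).map (fun q : U × (ℕ → U) => fun n => (Nat.casesOn n q.1 q.2 : U)) = dice μ := by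
  classical
  unfold dice
  refine Measure.eq_infinitePi _ fun s t ht => ?_
  have hfilt : s.filter (· ∈ Set.range Nat.succ) = s.filter (· ≠ 0) :=
    Finset.filter_congr fun n _ => by rw [Nat.range_succ, Set.mem_setOf_eq, Nat.pos_iff_ne_zero]
  rw [Measure.map_apply measurable_cons (MeasurableSet.pi s.countable_toSet fun i _ => ht i), cons_preimage_pi,
    Measure.prod_prod, Measure.infinitePi_pi _ (fun m _ => ht (m + 1)),
    prod_eq_ite_mul_prod_filter_ne_zero s fun n => μ (t n),
    Finset.prod_preimage' (f := Nat.succ) (g := fun n => μ (t n)), hfilt]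
  congr 1
  split_ifs <;> simp

omit [MeasurableSpace U] in
/-- `uncons ∘ cons = id`. [folklore] -/
theorem uncons_comp_cons :
    ((fun u : ℕ → U => (u 0, fun n => u (n + 1))) ∘ fun q : U × (ℕ → U) => fun n => (Nat.casesOn n q.1 q.2 : U)) =
      id := by
  funext q
  rfl

omit [MeasurableSpace U] in
/-- `cons ∘ uncons = id`. [folklore] -/
theorem cons_comp_uncons :
    ((fun q : U × (ℕ → U) => fun n => (Nat.casesOn n q.1 q.2 : U)) ∘ fun u : ℕ → U => (u 0, fun n => u (n + 1))) =
      id := by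
  funext u
  ext n
  cases n <;> rfl

/-- **Splitting off the first die**: under `μ^{⊗ℕ}` the pair (first die, remaining dice) has law `μ ⊗ μ^{⊗ℕ}` — the
head is `μ`-distributed and independent of the tail, itself an i.i.d. `μ` sequence. [folklore] -/
theorem map_uncons_dice : (dice μ).map (fun u : ℕ → U => (u 0, fun n => u (n + 1))) = μ.prod (dice μ) := by
  conv_lhs => rw [← map_cons_prod_dice μ]
  rw [Measure.map_map measurable_uncons measurable_cons, uncons_comp_cons, Measure.map_id]

/-- `uncons` is measure preserving `μ^{⊗ℕ} → μ ⊗ μ^{⊗ℕ}`. [folklore] -/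
theorem measurePreserving_uncons :
    MeasurePreserving (fun u : ℕ → U => (u 0, fun n => u (n + 1))) (dice μ) (μ.prod (dice μ)) :=
  ⟨measurable_uncons, map_uncons_dice μ⟩

/-- `cons` is measure preserving `μ ⊗ μ^{⊗ℕ} → μ^{⊗ℕ}`. [folklore] -/
theorem measurePreserving_cons :
    MeasurePreserving (fun q : U × (ℕ → U) => fun n => (Nat.casesOn n q.1 q.2 : U)) (μ.prod (dice μ)) (dice μ) :=
  ⟨measurable_cons, map_cons_prod_dice μ⟩

/-- `cons` is a measurable embedding (indeed a measurable equivalence with inverse `uncons`). [folklore] -/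
theorem measurableEmbedding_cons :
    MeasurableEmbedding fun q : U × (ℕ → U) => fun n => (Nat.casesOn n q.1 q.2 : U) :=
  (⟨⟨fun q : U × (ℕ → U) => fun n => (Nat.casesOn n q.1 q.2 : U), fun u : ℕ → U => (u 0, fun n => u (n + 1)),
      fun q => congrFun (uncons_comp_cons (U := U)) q, fun u => congrFun (cons_comp_uncons (U := U)) u⟩,
    measurable_cons, measurable_uncons⟩ : (U × (ℕ → U)) ≃ᵐ (ℕ → U)).measurableEmbedding

/-- **Conditioning on the first die**: `∫ F d(μ^{⊗ℕ}) = ∫ F (cons a v) d(μ ⊗ μ^{⊗ℕ})(a, v)` for every `F` (no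
measurability needed: `cons` is a measurable equivalence); with Fubini this is
`∫ F dμ^{⊗ℕ} = ∫ (∫ F (cons a v) dμ^{⊗ℕ}(v)) dμ(a)`. [folklore] -/
theorem integral_dice_eq_integral_prod {E : Type*} [NormedAddCommGroup E] [NormedSpace ℝ E] (F : (ℕ → U) → E) :
    ∫ u, F u ∂dice μ = ∫ q, F (fun n => (Nat.casesOn n q.1 q.2 : U)) ∂(μ.prod (dice μ)) :=
  ((measurePreserving_cons μ).integral_comp (measurableEmbedding_cons (U := U)) F).symm

/-- The `lintegral` form of the conditioning on the first die. [folklore] -/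
theorem lintegral_dice_eq_lintegral_prod (F : (ℕ → U) → ℝ≥0∞) :
    ∫⁻ u, F u ∂dice μ = ∫⁻ q, F (fun n => (Nat.casesOn n q.1 q.2 : U)) ∂(μ.prod (dice μ)) :=
  ((measurePreserving_cons μ).lintegral_comp_emb (measurableEmbedding_cons (U := U)) F).symm

/-- **Almost-sure statements split too**: a property holds for `μ^{⊗ℕ}`-a.e. sequence iff it holds for
`μ ⊗ μ^{⊗ℕ}`-a.e. `(a, v)` at `cons a v`. [folklore] -/
theorem ae_dice_iff_ae_prod {P : (ℕ → U) → Prop} :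
    (∀ᵐ u ∂dice μ, P u) ↔ ∀ᵐ q ∂(μ.prod (dice μ)), P (fun n => (Nat.casesOn n q.1 q.2 : U)) := by
  conv_lhs => rw [← (measurePreserving_cons μ).map_eq]
  exact (measurableEmbedding_cons (U := U)).ae_map_iff

end Literature.MathematicalPhysics.KineticTheory.KernelGas

end
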